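import Literature.Analysis.FunctionSpaces.LpDualityTestFunctions
import HarnessLib

/-!
# Mixed-norm bounds by duality against smooth test functions on a space–time cylinder

Analysis/FunctionSpaces support file (all results proved, [folklore]). It serves the discharge of
the pressure term (13.28)–(13.29) of Lemarié-Rieusset 2016, Lemma 13.3
(`Literature.Analysis.FluidPDE.LemarieRieusset2016.step1_pressureTerm`,
`FluidPDE/CKNMorreyLocalEnergySteps`), where `∬ |p| |u|` over a cylinder `I × B` is bounded by
testing the pressure `p` against `Ψ ∈ C_c^∞(I × B)` and bounding `|∫∫ p Ψ|` by a *mixed*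
space–time functional of `Ψ` (the pressure is split only in dual form: the harmonic part is paid
in `L¹_x`, the Calderón–Zygmund part in `L^r_x`, slice by slice in time).

Let `X` be a finite-dimensional real normed space with its Haar measure `volume`, `I ⊆ ℝ` and
`B ⊆ X` open with `|B| < ∞`, `S = I × B`, `E ∈ L¹(S)` real, `α, β ≥ 0` a.e.-measurable on `I` with
`∫_I α, ∫_I β < ∞`, and `r > 0`. Suppose that for every smooth compactly supported `Ψ` with
`tsupport Ψ ⊆ S`,

  `‖∫_S E Ψ‖ ≤ ∫_I (α(s) ‖Ψ(s,·)‖_{L¹} + β(s) ‖Ψ(s,·)‖_{L^r}) ds`.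

* `enorm_setIntegral_mul_le_mixed_of_forall_test` — the same bound for every bounded strongly
  measurable `g` vanishing off a compact subset of `S` (mollify `g`; the mollified functions are
  test functions supported in `S`, uniformly bounded, and converge to `g` a.e. (Lebesgue
  differentiation, Mathlib's `ContDiffBump.ae_convolution_tendsto_right_of_locallyIntegrable`),
  hence — Fubini for null sets — for a.e. `s` they converge for a.e. `y`; dominated convergence
  on `B` slice-wise, then on `I`, and on the `E` side);
* `lintegral_enorm_mul_le_mixed_of_forall_test` — for every a.e.-measurable `g ≥ 0` on `S`,
  `∫_S |E| g ≤ ∫_I (α(s) ∫_B g(s,·) + β(s) (∫_B g(s,·)^r)^{1/r}) ds` (test with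
  `𝟙_{K_k} sgn(E) min(g, k)` along a compact exhaustion `K_k ↑ S`, monotone convergence).

Companion of `LpDualityTestFunctions` (the single-norm case `|∫ E Ψ| ≤ M ‖Ψ‖_{L^q}`).

## References

* H. Brezis, *Functional Analysis, Sobolev Spaces and Partial Differential Equations* (2011),
  Prop. 3.5, Thm. 4.11, Cor. 4.24 (duality and density of test functions).
* P. G. Lemarié-Rieusset, *The Navier–Stokes Problem in the 21st Century*, CRC Press (2016),
  §13.9 p. 469 (the mixed `L^{q₀}_t L^∞_x` / `L^{3/2}_{t,x}` splitting of the local pressure).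
-/

noncomputable section

open MeasureTheory TopologicalSpace Set Function Filter Topology ContinuousLinearMap Metric
open scoped ENNReal NNReal Convolution Pointwise

namespace Literature.Analysis.FunctionSpaces

variable {X : Type*} [NormedAddCommGroup X] [NormedSpace ℝ X] [FiniteDimensional ℝ X]
  [MeasureSpace X] [BorelSpace X] [(volume : Measure X).IsAddHaarMeasure]

/-! ### Tools -/

omit [NormedSpace ℝ X] [FiniteDimensional ℝ X] [BorelSpace X]
  [(volume : Measure X).IsAddHaarMeasure] in
/-- `⨆ k, min a k = a` in `ℝ≥0∞` along the natural numbers. [folklore] -/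
theorem iSup_min_natCast (a : ℝ≥0∞) : ⨆ k : ℕ, min a (k : ℝ≥0∞) = a := by
  refine le_antisymm (iSup_le fun k => min_le_left _ _) ?_
  rcases eq_or_ne a ⊤ with rfl | ha
  · simp only [min_eq_right le_top, ENNReal.iSup_natCast, le_refl]
  · obtain ⟨k, hk⟩ := ENNReal.exists_nat_gt ha
    exact le_iSup_of_le k (by rw [min_eq_left hk.le])

omit [NormedAddCommGroup X] [NormedSpace ℝ X] [FiniteDimensional ℝ X] [BorelSpace X]
  [(volume : Measure X).IsAddHaarMeasure] in
/-- Slices of a bounded function have bounded integrals over a set: `∫_B ‖g(s,·)‖ₑ ≤ C |B|`.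
[folklore] -/
theorem lintegral_enorm_slice_le {g : ℝ × X → ℝ} {C : ℝ} (hgC : ∀ z, |g z| ≤ C) (B : Set X)
    (s : ℝ) : ∫⁻ y in B, ‖g (s, y)‖ₑ ≤ ENNReal.ofReal C * volume B := by
  calc ∫⁻ y in B, ‖g (s, y)‖ₑ ≤ ∫⁻ _ in B, ENNReal.ofReal C := by
        refine lintegral_mono fun y => ?_
        rw [Real.enorm_eq_ofReal_abs]
        exact ENNReal.ofReal_le_ofReal (hgC _)
    _ = ENNReal.ofReal C * volume B := setLIntegral_const _ _

omit [NormedAddCommGroup X] [NormedSpace ℝ X] [FiniteDimensional ℝ X] [BorelSpace X]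
  [(volume : Measure X).IsAddHaarMeasure] in
/-- Slices of a bounded function: `∫_B ‖g(s,·)‖ₑ^r ≤ C^r |B|` (`r > 0`). [folklore] -/
theorem lintegral_enorm_rpow_slice_le {g : ℝ × X → ℝ} {C : ℝ} (hgC : ∀ z, |g z| ≤ C) {r : ℝ}
    (hr : 0 < r) (B : Set X) (s : ℝ) :
    ∫⁻ y in B, ‖g (s, y)‖ₑ ^ r ≤ ENNReal.ofReal C ^ r * volume B := by
  calc ∫⁻ y in B, ‖g (s, y)‖ₑ ^ r ≤ ∫⁻ _ in B, ENNReal.ofReal C ^ r := by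
        refine lintegral_mono fun y => ENNReal.rpow_le_rpow ?_ hr.le
        rw [Real.enorm_eq_ofReal_abs]
        exact ENNReal.ofReal_le_ofReal (hgC _)
    _ = ENNReal.ofReal C ^ r * volume B := setLIntegral_const _ _

/-! ### Extension of the test-function bound to bounded functions -/

/-- **Extension of a mixed-norm test-function bound to bounded functions supported in a compact
subset.** Let `I ⊆ ℝ`, `B ⊆ X` be open with `|B| < ∞`, `E ∈ L¹(I × B)`, `α, β` a.e.-measurable on
`I` with finite integrals, `r > 0`, and suppose
`‖∫_{I×B} E Ψ‖ ≤ ∫_I (α(s) ∫ |Ψ(s,·)| + β(s) (∫ |Ψ(s,·)|^r)^{1/r}) ds` for every smooth compactly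
supported `Ψ` with `tsupport Ψ ⊆ I × B`. Then the same bound (with the slice integrals over `B`)
holds for every strongly measurable `g` with `|g| ≤ C` vanishing off a compact `K ⊆ I × B`.
Proof: mollify `g`; for small radius the mollified functions are test functions supported in a
fixed compact neighbourhood of `K` inside `I × B`, bounded by `C`, and converge to `g` a.e., hence
for a.e. `s` they converge for a.e. `y` (Fubini for null sets); dominated convergence slice-wise
on `B`, then on `I` (dominating function `α C|B| + β C|B|^{1/r}`), and on the `E` side. [folklore] -/
theorem enorm_setIntegral_mul_le_mixed_of_forall_test {I : Set ℝ} (hI : IsOpen I) {B : Set X}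
    (hB : IsOpen B) (hBfin : volume B ≠ ∞) {E : ℝ × X → ℝ} (hE : IntegrableOn E (I ×ˢ B) volume)
    {α β : ℝ → ℝ≥0∞} (hα : AEMeasurable α (volume.restrict I))
    (hβ : AEMeasurable β (volume.restrict I)) (hαI : ∫⁻ s in I, α s ≠ ∞)
    (hβI : ∫⁻ s in I, β s ≠ ∞) {r : ℝ} (hr : 0 < r)
    (h : ∀ Ψ : ℝ × X → ℝ, ContDiff ℝ (⊤ : ℕ∞) Ψ → HasCompactSupport Ψ → tsupport Ψ ⊆ I ×ˢ B →
      ‖∫ z in I ×ˢ B, E z * Ψ z‖ₑ ≤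
        ∫⁻ s in I, α s * (∫⁻ y, ‖Ψ (s, y)‖ₑ) + β s * (∫⁻ y, ‖Ψ (s, y)‖ₑ ^ r) ^ (1 / r))
    {K : Set (ℝ × X)} (hK : IsCompact K) (hKS : K ⊆ I ×ˢ B) {g : ℝ × X → ℝ}
    (hgm : StronglyMeasurable g) {C : ℝ} (hgC : ∀ z, |g z| ≤ C) (hgK : ∀ z, z ∉ K → g z = 0) :
    ‖∫ z in I ×ˢ B, E z * g z‖ₑ ≤
      ∫⁻ s in I, α s * (∫⁻ y in B, ‖g (s, y)‖ₑ) +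
        β s * (∫⁻ y in B, ‖g (s, y)‖ₑ ^ r) ^ (1 / r) := by
  haveI : (volume : Measure (ℝ × X)).IsAddHaarMeasure := by
    rw [Measure.volume_eq_prod]; infer_instance
  set S : Set (ℝ × X) := I ×ˢ B with hS
  have hSo : IsOpen S := hI.prod hB
  -- room around `K` inside `S`
  obtain ⟨δ, hδ, hδS⟩ := hK.exists_cthickening_subset_open hSo hKS
  -- the class of `g`
  have hC : 0 ≤ C := (abs_nonneg _).trans (hgC 0)
  have hgc : HasCompactSupport g := HasCompactSupport.intro hK hgK
  have hgam : AEStronglyMeasurable g volume := hgm.aestronglyMeasurable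
  have hgsupp : support g ⊆ K := fun x hx => by_contra fun hxK => hx (hgK x hxK)
  have hgn : ∀ x, ‖g x‖ ≤ C := fun x => (Real.norm_eq_abs _).trans_le (hgC x)
  have hgi : Integrable g volume := by
    rw [← integrableOn_iff_integrable_of_support_subset hgsupp]
    exact Measure.integrableOn_of_bounded hK.measure_lt_top.ne hgam (Eventually.of_forall hgn)
  have hgl : LocallyIntegrable g volume := hgi.locallyIntegrable
  -- the mollifier sequence
  obtain ⟨φ, hφ0, hφ2⟩ := exists_contDiffBump_seq (E := ℝ × X)
  set gs : ℕ → ℝ × X → ℝ := fun n => (φ n).normed volume ⋆[lsmul ℝ ℝ, volume] g with hgs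
  have hev : ∀ᶠ n in atTop, (φ n).rOut < δ := hφ0.eventually (gt_mem_nhds hδ)
  have hsm : ∀ n, ContDiff ℝ (⊤ : ℕ∞) (gs n) := fun n =>
    (φ n).hasCompactSupport_normed.contDiff_convolution_left _ (φ n).contDiff_normed hgl
  have hcs : ∀ n, HasCompactSupport (gs n) := fun n =>
    (φ n).hasCompactSupport_normed.convolution _ hgc
  have hts : ∀ n, (φ n).rOut ≤ δ → tsupport (gs n) ⊆ S := by
    intro n hn
    refine Subset.trans (closure_minimal ?_ isClosed_cthickening)
      ((cthickening_mono hn K).trans hδS)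
    intro x hx
    have h1 := support_convolution_subset (L := lsmul ℝ ℝ) (μ := volume)
      (f := (φ n).normed volume) (g := g) hx
    rw [(φ n).support_normed_eq] at h1
    obtain ⟨a, ha, b, hb, rfl⟩ := h1
    refine thickening_subset_cthickening _ _ (mem_thickening_iff.2 ⟨b, hgsupp hb, ?_⟩)
    rw [dist_eq_norm, add_sub_cancel_right]
    exact mem_ball_zero_iff.1 ha
  have hbd : ∀ n x, |gs n x| ≤ C := by
    intro n x
    have := dist_convolution_le (μ := volume) (x₀ := x) (z₀ := (0 : ℝ)) hC
      (φ n).support_normed_eq.subset (φ n).nonneg_normed (φ n).integral_normed hgam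
      (fun y _ => by rw [dist_zero_right]; exact hgn y)
    rwa [Real.dist_eq, sub_zero] at this
  -- the mollified functions vanish off `S` (for small radius)
  have hzero : ∀ n, (φ n).rOut ≤ δ → ∀ z, z ∉ S → gs n z = 0 := fun n hn z hz =>
    image_eq_zero_of_notMem_tsupport fun h' => hz (hts n hn h')
  -- a.e. convergence, and its sliced form
  have hae : ∀ᵐ x ∂(volume : Measure (ℝ × X)), Tendsto (fun n => gs n x) atTop (𝓝 (g x)) :=
    ContDiffBump.ae_convolution_tendsto_right_of_locallyIntegrable hφ0
      (Eventually.of_forall hφ2) hgl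
  have hae' : ∀ᵐ s ∂(volume : Measure ℝ), ∀ᵐ y ∂(volume : Measure X),
      Tendsto (fun n => gs n (s, y)) atTop (𝓝 (g (s, y))) := by
    rw [Measure.volume_eq_prod] at hae
    exact Measure.ae_ae_of_ae_prod hae
  -- dominated convergence on the `E` side
  have hlim : Tendsto (fun n => ∫ z in S, E z * gs n z) atTop (𝓝 (∫ z in S, E z * g z)) := by
    refine tendsto_integral_of_dominated_convergence (fun x => C * ‖E x‖)
      (fun n => hE.aestronglyMeasurable.mul
        (hsm n).continuous.aestronglyMeasurable) (hE.norm.const_mul C) (fun n => ?_) ?_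
    · filter_upwards with x
      rw [norm_mul, mul_comm]
      exact mul_le_mul_of_nonneg_right ((Real.norm_eq_abs _).trans_le (hbd n x))
        (norm_nonneg _)
    · exact (ae_restrict_of_ae hae).mono fun x hx => hx.const_mul (E x)
  have hlim' : Tendsto (fun n => ‖∫ z in S, E z * gs n z‖ₑ) atTop
      (𝓝 ‖∫ z in S, E z * g z‖ₑ) := (continuous_enorm.tendsto _).comp hlim
  -- the slice functionals
  set A : ℕ → ℝ → ℝ≥0∞ := fun n s => ∫⁻ y in B, ‖gs n (s, y)‖ₑ with hA
  set A' : ℝ → ℝ≥0∞ := fun s => ∫⁻ y in B, ‖g (s, y)‖ₑ with hA'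
  set P : ℕ → ℝ → ℝ≥0∞ := fun n s => ∫⁻ y in B, ‖gs n (s, y)‖ₑ ^ r with hP
  set P' : ℝ → ℝ≥0∞ := fun s => ∫⁻ y in B, ‖g (s, y)‖ₑ ^ r with hP'
  have hAm : ∀ n, Measurable (A n) := fun n =>
    ((hsm n).continuous.measurable.enorm).lintegral_prod_right'
  have hPm : ∀ n, Measurable (P n) := fun n =>
    ((hsm n).continuous.measurable.enorm.pow_const r).lintegral_prod_right'
  have hAbd : ∀ n s, A n s ≤ ENNReal.ofReal C * volume B := fun n s =>
    lintegral_enorm_slice_le (hbd n) B s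
  have hPbd : ∀ n s, P n s ≤ ENNReal.ofReal C ^ r * volume B := fun n s =>
    lintegral_enorm_rpow_slice_le (hbd n) hr B s
  have hCB : ENNReal.ofReal C * volume B ≠ ∞ := ENNReal.mul_ne_top ENNReal.ofReal_ne_top hBfin
  have hCBr : ENNReal.ofReal C ^ r * volume B ≠ ∞ :=
    ENNReal.mul_ne_top (ENNReal.rpow_ne_top_of_nonneg hr.le ENNReal.ofReal_ne_top) hBfin
  -- slice-wise dominated convergence
  have hAlim : ∀ᵐ s ∂(volume : Measure ℝ), Tendsto (fun n => A n s) atTop (𝓝 (A' s)) := by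
    filter_upwards [hae'] with s hs
    refine tendsto_lintegral_of_dominated_convergence (fun _ => ENNReal.ofReal C)
      (fun n => ((hsm n).continuous.measurable.comp (measurable_const.prodMk measurable_id)).enorm)
      (fun n => Eventually.of_forall fun y => ?_) ?_ ?_
    · change ‖gs n (s, y)‖ₑ ≤ ENNReal.ofReal C
      rw [Real.enorm_eq_ofReal_abs]
      exact ENNReal.ofReal_le_ofReal (hbd n _)
    · rw [setLIntegral_const]; exact hCB
    · exact (ae_restrict_of_ae hs).mono fun y hy => (continuous_enorm.tendsto _).comp hy
  have hPlim : ∀ᵐ s ∂(volume : Measure ℝ),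
      Tendsto (fun n => P n s ^ (1 / r)) atTop (𝓝 (P' s ^ (1 / r))) := by
    filter_upwards [hae'] with s hs
    refine ((ENNReal.continuous_rpow_const (y := 1 / r)).tendsto _).comp ?_
    refine tendsto_lintegral_of_dominated_convergence (fun _ => ENNReal.ofReal C ^ r)
      (fun n => ((hsm n).continuous.measurable.comp
        (measurable_const.prodMk measurable_id)).enorm.pow_const r)
      (fun n => Eventually.of_forall fun y => ?_) ?_ ?_
    · change ‖gs n (s, y)‖ₑ ^ r ≤ ENNReal.ofReal C ^ r
      refine ENNReal.rpow_le_rpow ?_ hr.le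
      rw [Real.enorm_eq_ofReal_abs]
      exact ENNReal.ofReal_le_ofReal (hbd n _)
    · rw [setLIntegral_const]; exact hCBr
    · exact (ae_restrict_of_ae hs).mono fun y hy =>
        ((ENNReal.continuous_rpow_const (y := r)).tendsto _).comp
          ((continuous_enorm.tendsto _).comp hy)
  -- `α, β` are finite a.e. on `I`
  have hαfin : ∀ᵐ s ∂(volume.restrict I), α s < ∞ := ae_lt_top' hα hαI
  have hβfin : ∀ᵐ s ∂(volume.restrict I), β s < ∞ := ae_lt_top' hβ hβI
  -- dominated convergence in time
  set F : ℕ → ℝ → ℝ≥0∞ := fun n s => α s * A n s + β s * P n s ^ (1 / r) with hF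
  set F' : ℝ → ℝ≥0∞ := fun s => α s * A' s + β s * P' s ^ (1 / r) with hF'
  set bound : ℝ → ℝ≥0∞ := fun s => α s * (ENNReal.ofReal C * volume B) +
    β s * (ENNReal.ofReal C ^ r * volume B) ^ (1 / r) with hbound
  have hFlim : Tendsto (fun n => ∫⁻ s in I, F n s) atTop (𝓝 (∫⁻ s in I, F' s)) := by
    refine tendsto_lintegral_of_dominated_convergence' bound (fun n => ?_) (fun n => ?_) ?_ ?_
    · exact (hα.mul (hAm n).aemeasurable).add (hβ.mul ((hPm n).pow_const _).aemeasurable)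
    · refine Eventually.of_forall fun s => add_le_add (mul_le_mul_right (hAbd n s) _)
        (mul_le_mul_right (ENNReal.rpow_le_rpow (hPbd n s) (by positivity)) _)
    · rw [hbound]
      rw [lintegral_add_right' _ (hβ.mul_const _), lintegral_mul_const'' _ hα,
        lintegral_mul_const'' _ hβ]
      exact ENNReal.add_ne_top.2 ⟨ENNReal.mul_ne_top hαI hCB,
        ENNReal.mul_ne_top hβI (ENNReal.rpow_ne_top_of_nonneg (by positivity) hCBr)⟩
    · filter_upwards [ae_restrict_of_ae (μ := volume) (s := I) hAlim,
        ae_restrict_of_ae (μ := volume) (s := I) hPlim, hαfin, hβfin] with s hsA hsP hsα hsβ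
      exact (ENNReal.Tendsto.const_mul hsA (Or.inr hsα.ne)).add
        (ENNReal.Tendsto.const_mul hsP (Or.inr hsβ.ne))
  -- the bound for the mollified functions, eventually
  have hevb : ∀ᶠ n in atTop, ‖∫ z in S, E z * gs n z‖ₑ ≤ ∫⁻ s in I, F n s := by
    filter_upwards [hev] with n hn
    refine (h (gs n) (hsm n) (hcs n) (hts n hn.le)).trans (le_of_eq ?_)
    refine lintegral_congr fun s => ?_
    have hsuppA : support (fun y => ‖gs n (s, y)‖ₑ) ⊆ B := by
      intro y hy
      by_contra hyB
      refine hy ?_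
      have : (s, y) ∉ S := fun hS' => hyB hS'.2
      simp [hzero n hn.le _ this]
    have hsuppP : support (fun y => ‖gs n (s, y)‖ₑ ^ r) ⊆ B := by
      intro y hy
      by_contra hyB
      refine hy ?_
      have : (s, y) ∉ S := fun hS' => hyB hS'.2
      simp [hzero n hn.le _ this, ENNReal.zero_rpow_of_pos hr]
    simp only [hF, hA, hP]
    rw [setLIntegral_eq_of_support_subset hsuppA, setLIntegral_eq_of_support_subset hsuppP]
  exact le_of_tendsto_of_tendsto hlim' hFlim hevb

/-! ### The bound for nonnegative measurable functions -/

/-- The measurable case of `lintegral_enorm_mul_le_mixed_of_forall_test`. [folklore] -/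
theorem lintegral_enorm_mul_le_mixed_of_forall_test_of_measurable {I : Set ℝ} (hI : IsOpen I)
    {B : Set X} (hB : IsOpen B) (hBfin : volume B ≠ ∞) {E : ℝ × X → ℝ}
    (hE : IntegrableOn E (I ×ˢ B) volume) {α β : ℝ → ℝ≥0∞}
    (hα : AEMeasurable α (volume.restrict I)) (hβ : AEMeasurable β (volume.restrict I))
    (hαI : ∫⁻ s in I, α s ≠ ∞) (hβI : ∫⁻ s in I, β s ≠ ∞) {r : ℝ} (hr : 0 < r)
    (h : ∀ Ψ : ℝ × X → ℝ, ContDiff ℝ (⊤ : ℕ∞) Ψ → HasCompactSupport Ψ → tsupport Ψ ⊆ I ×ˢ B →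
      ‖∫ z in I ×ˢ B, E z * Ψ z‖ₑ ≤
        ∫⁻ s in I, α s * (∫⁻ y, ‖Ψ (s, y)‖ₑ) + β s * (∫⁻ y, ‖Ψ (s, y)‖ₑ ^ r) ^ (1 / r))
    {g : ℝ × X → ℝ≥0∞} (hg : Measurable g) :
    ∫⁻ z in I ×ˢ B, ‖E z‖ₑ * g z ≤
      ∫⁻ s in I, α s * (∫⁻ y in B, g (s, y)) + β s * (∫⁻ y in B, g (s, y) ^ r) ^ (1 / r) := by
  set S : Set (ℝ × X) := I ×ˢ B with hS
  have hSo : IsOpen S := hI.prod hB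
  -- ### a strongly measurable representative `F` of `E` on `S`
  set F : ℝ × X → ℝ := hE.aestronglyMeasurable.mk E with hF_def
  have hFm : StronglyMeasurable F := hE.aestronglyMeasurable.stronglyMeasurable_mk
  have hEF : E =ᵐ[volume.restrict S] F := hE.aestronglyMeasurable.ae_eq_mk
  have hFi : IntegrableOn F S volume := Integrable.congr hE hEF
  have hF : ∀ Ψ : ℝ × X → ℝ, ContDiff ℝ (⊤ : ℕ∞) Ψ → HasCompactSupport Ψ → tsupport Ψ ⊆ S →
      ‖∫ z in S, F z * Ψ z‖ₑ ≤
        ∫⁻ s in I, α s * (∫⁻ y, ‖Ψ (s, y)‖ₑ) + β s * (∫⁻ y, ‖Ψ (s, y)‖ₑ ^ r) ^ (1 / r) := by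
    intro Ψ h1 h2 h3
    rw [← integral_congr_ae (show (fun z => E z * Ψ z) =ᵐ[volume.restrict S] fun z => F z * Ψ z
      from hEF.mono fun z hz => by simp only [hz])]
    exact h Ψ h1 h2 h3
  suffices hmain : ∫⁻ z in S, ‖F z‖ₑ * g z ≤
      ∫⁻ s in I, α s * (∫⁻ y in B, g (s, y)) + β s * (∫⁻ y in B, g (s, y) ^ r) ^ (1 / r) by
    rw [lintegral_congr_ae (show (fun z => ‖E z‖ₑ * g z) =ᵐ[volume.restrict S]
      fun z => ‖F z‖ₑ * g z from hEF.mono fun z hz => by simp only [hz])]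
    exact hmain
  -- ### the exhaustion and the test functions `gk = 𝟙_{K k} sgn(F) min(g, k)`
  obtain ⟨K, hKc, hKS, hKmono, hKcov⟩ := exists_compact_exhaustion_of_isOpen hSo
  set sgn : ℝ × X → ℝ := fun z => if 0 ≤ F z then 1 else -1 with hsgn
  have hsgnm : Measurable sgn :=
    Measurable.ite (measurableSet_le measurable_const hFm.measurable) measurable_const
      measurable_const
  have hsgn_abs : ∀ z, |sgn z| = 1 := fun z => by
    rw [hsgn]; dsimp only; split_ifs <;> simp
  have hFsgn : ∀ z, F z * sgn z = |F z| := fun z => by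
    rw [hsgn]; dsimp only
    split_ifs with h0
    · rw [mul_one, abs_of_nonneg h0]
    · rw [mul_neg, mul_one, abs_of_neg (not_le.1 h0)]
  set gk : ℕ → ℝ × X → ℝ := fun k =>
    (K k).indicator fun z => sgn z * (min (g z) (k : ℝ≥0∞)).toReal with hgk_def
  have hmink : ∀ (k : ℕ) z, min (g z) (k : ℝ≥0∞) ≠ ∞ := fun k z =>
    ne_top_of_le_ne_top (ENNReal.natCast_ne_top k) (min_le_right _ _)
  have hgkm : ∀ k, StronglyMeasurable (gk k) := fun k =>
    (hsgnm.mul (hg.min measurable_const).ennreal_toReal).stronglyMeasurable.indicator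
      (hKc k).isClosed.measurableSet
  have hgkC : ∀ k z, |gk k z| ≤ k := by
    intro k z
    rw [hgk_def]; dsimp only
    by_cases hz : z ∈ K k
    · rw [indicator_of_mem hz, abs_mul, hsgn_abs, one_mul, abs_of_nonneg ENNReal.toReal_nonneg]
      have := ENNReal.toReal_mono (ENNReal.natCast_ne_top k) (min_le_right (g z) (k : ℝ≥0∞))
      rwa [ENNReal.toReal_natCast] at this
    · rw [indicator_of_notMem hz, abs_zero]; exact Nat.cast_nonneg k
  have hgkK : ∀ k z, z ∉ K k → gk k z = 0 := fun k z hz => indicator_of_notMem hz _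
  -- `‖gk‖ₑ ≤ g`
  have hgk_le : ∀ k z, ‖gk k z‖ₑ ≤ g z := by
    intro k z
    rw [Real.enorm_eq_ofReal_abs, hgk_def]; dsimp only
    by_cases hz : z ∈ K k
    · rw [indicator_of_mem hz, abs_mul, hsgn_abs, one_mul, abs_of_nonneg ENNReal.toReal_nonneg]
      exact ENNReal.ofReal_toReal_le.trans (min_le_left _ _)
    · rw [indicator_of_notMem hz, abs_zero, ENNReal.ofReal_zero]; exact zero_le
  -- `F · gk = 𝟙_{K k} |F| min(g, k)`
  set Lk : ℕ → ℝ × X → ℝ≥0∞ := fun k =>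
    (K k).indicator fun z => ‖F z‖ₑ * min (g z) (k : ℝ≥0∞) with hLk_def
  have hFgk : ∀ k z, F z * gk k z = (Lk k z).toReal := by
    intro k z
    rw [hgk_def, hLk_def]; dsimp only
    by_cases hz : z ∈ K k
    · rw [indicator_of_mem hz, indicator_of_mem hz, ← mul_assoc, hFsgn, ENNReal.toReal_mul,
        toReal_enorm, Real.norm_eq_abs]
    · rw [indicator_of_notMem hz, indicator_of_notMem hz, mul_zero, ENNReal.toReal_zero]
  have hLk_top : ∀ k z, Lk k z ≠ ∞ := by
    intro k z
    rw [hLk_def]; dsimp only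
    by_cases hz : z ∈ K k
    · rw [indicator_of_mem hz]; exact ENNReal.mul_ne_top enorm_ne_top (hmink k z)
    · rw [indicator_of_notMem hz]; exact ENNReal.zero_ne_top
  have hLkm : ∀ k, Measurable (Lk k) := fun k =>
    (hFm.measurable.enorm.mul (hg.min measurable_const)).indicator (hKc k).isClosed.measurableSet
  have hLk_le : ∀ k z, Lk k z ≤ (k : ℝ≥0∞) * ‖F z‖ₑ := by
    intro k z
    rw [hLk_def]; dsimp only
    by_cases hz : z ∈ K k
    · rw [indicator_of_mem hz, mul_comm]; exact mul_le_mul_left (min_le_right _ _) _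
    · rw [indicator_of_notMem hz]; exact zero_le
  have hLk_fin : ∀ k, ∫⁻ z in S, Lk k z ≠ ∞ := by
    intro k
    refine ne_top_of_le_ne_top ?_ (lintegral_mono (hLk_le k))
    rw [lintegral_const_mul' _ _ (ENNReal.natCast_ne_top k)]
    exact ENNReal.mul_ne_top (ENNReal.natCast_ne_top k) hFi.2.ne
  -- the left-hand side for `gk` is `∫_S Lk`
  have hlhs : ∀ k, ‖∫ z in S, F z * gk k z‖ₑ = ∫⁻ z in S, Lk k z := by
    intro k
    simp_rw [hFgk k]
    rw [integral_toReal (hLkm k).aemeasurable.restrict (Eventually.of_forall fun z =>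
      (hLk_top k z).lt_top), Real.enorm_eq_ofReal ENNReal.toReal_nonneg,
      ENNReal.ofReal_toReal (hLk_fin k)]
  -- ### the bound `∫_S Lk ≤ Φ(g)`
  have hstep : ∀ k, ∫⁻ z in S, Lk k z ≤
      ∫⁻ s in I, α s * (∫⁻ y in B, g (s, y)) + β s * (∫⁻ y in B, g (s, y) ^ r) ^ (1 / r) := by
    intro k
    rw [← hlhs k]
    refine (enorm_setIntegral_mul_le_mixed_of_forall_test hI hB hBfin hFi hα hβ hαI hβI hr hF
      (hKc k) (hKS k) (hgkm k) (hgkC k) (hgkK k)).trans ?_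
    refine lintegral_mono fun s => add_le_add (mul_le_mul_right (lintegral_mono fun y =>
      hgk_le k _) _) (mul_le_mul_right (ENNReal.rpow_le_rpow (lintegral_mono fun y =>
        ENNReal.rpow_le_rpow (hgk_le k _) hr.le) (by positivity)) _)
  -- ### monotone convergence
  have hind : ∀ z, S.indicator (fun z => ‖F z‖ₑ * g z) z = ⨆ k, Lk k z := by
    intro z
    by_cases hz : z ∈ S
    · rw [indicator_of_mem hz]
      refine le_antisymm ?_ (iSup_le fun k => ?_)
      · obtain ⟨k₀, hk₀⟩ := hKcov z hz
        calc ‖F z‖ₑ * g z = ‖F z‖ₑ * ⨆ k : ℕ, min (g z) (k : ℝ≥0∞) := by rw [iSup_min_natCast]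
          _ = ⨆ k : ℕ, ‖F z‖ₑ * min (g z) (k : ℝ≥0∞) := ENNReal.mul_iSup _ _
          _ ≤ ⨆ k, Lk k z := iSup_le fun k => ?_
        refine le_iSup_of_le (max k₀ k) ?_
        rw [hLk_def]; dsimp only
        rw [indicator_of_mem (hk₀ _ (le_max_left _ _))]
        gcongr
        exact_mod_cast le_max_right k₀ k
      · rw [hLk_def]; dsimp only
        by_cases hzk : z ∈ K k
        · rw [indicator_of_mem hzk]; gcongr; exact min_le_left _ _
        · rw [indicator_of_notMem hzk]; exact zero_le
    · rw [indicator_of_notMem hz]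
      refine le_antisymm zero_le (iSup_le fun k => le_of_eq ?_)
      rw [hLk_def]; dsimp only
      rw [indicator_of_notMem fun hzk => hz (hKS k hzk)]
  have hLkmono : Monotone Lk := by
    intro k l hkl z
    rw [hLk_def]; dsimp only
    by_cases hzk : z ∈ K k
    · rw [indicator_of_mem hzk, indicator_of_mem (hKmono hkl hzk)]
      gcongr
    · rw [indicator_of_notMem hzk]; exact zero_le
  have hLkS : ∀ k, ∫⁻ z in S, Lk k z = ∫⁻ z, Lk k z := fun k =>
    setLIntegral_eq_of_support_subset fun z hz => by
      by_contra hzS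
      refine hz ?_
      rw [hLk_def]; dsimp only
      rw [indicator_of_notMem fun hzk => hzS (hKS k hzk)]
  calc ∫⁻ z in S, ‖F z‖ₑ * g z = ∫⁻ z, S.indicator (fun z => ‖F z‖ₑ * g z) z :=
        (lintegral_indicator hSo.measurableSet _).symm
    _ = ∫⁻ z, ⨆ k, Lk k z := lintegral_congr hind
    _ = ⨆ k, ∫⁻ z, Lk k z := lintegral_iSup hLkm hLkmono
    _ = ⨆ k, ∫⁻ z in S, Lk k z := by simp_rw [hLkS]
    _ ≤ _ := iSup_le hstep

/-- **Mixed-norm bound for `∫ |E| g` from a bound on pairings with test functions.** Let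
`I ⊆ ℝ`, `B ⊆ X` be open with `|B| < ∞`, `E ∈ L¹(I × B)`, `α, β` a.e.-measurable on `I` with
finite integrals, `r > 0`, and suppose
`‖∫_{I×B} E Ψ‖ ≤ ∫_I (α(s) ‖Ψ(s,·)‖_{L¹} + β(s) ‖Ψ(s,·)‖_{L^r}) ds` for every smooth compactly
supported `Ψ` with `tsupport Ψ ⊆ I × B`. Then for every a.e.-measurable `g ≥ 0` on `I × B`,
`∫_{I×B} |E| g ≤ ∫_I (α(s) ∫_B g(s,·) + β(s) (∫_B g(s,·)^r)^{1/r}) ds` (in `[0, ∞]`). Proof: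
along a compact exhaustion `K_k ↑ I × B`, test (`enorm_setIntegral_mul_le_mixed_of_forall_test`)
with `g_k = 𝟙_{K_k} sgn(E) min(g, k)`, for which `∫ E g_k = ∫_{K_k} |E| min(g, k)` and
`|g_k| ≤ g`; monotone convergence in `k`. [folklore] -/
theorem lintegral_enorm_mul_le_mixed_of_forall_test {I : Set ℝ} (hI : IsOpen I) {B : Set X}
    (hB : IsOpen B) (hBfin : volume B ≠ ∞) {E : ℝ × X → ℝ} (hE : IntegrableOn E (I ×ˢ B) volume)
    {α β : ℝ → ℝ≥0∞} (hα : AEMeasurable α (volume.restrict I))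
    (hβ : AEMeasurable β (volume.restrict I)) (hαI : ∫⁻ s in I, α s ≠ ∞)
    (hβI : ∫⁻ s in I, β s ≠ ∞) {r : ℝ} (hr : 0 < r)
    (h : ∀ Ψ : ℝ × X → ℝ, ContDiff ℝ (⊤ : ℕ∞) Ψ → HasCompactSupport Ψ → tsupport Ψ ⊆ I ×ˢ B →
      ‖∫ z in I ×ˢ B, E z * Ψ z‖ₑ ≤
        ∫⁻ s in I, α s * (∫⁻ y, ‖Ψ (s, y)‖ₑ) + β s * (∫⁻ y, ‖Ψ (s, y)‖ₑ ^ r) ^ (1 / r))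
    {g : ℝ × X → ℝ≥0∞} (hg : AEMeasurable g (volume.restrict (I ×ˢ B))) :
    ∫⁻ z in I ×ˢ B, ‖E z‖ₑ * g z ≤
      ∫⁻ s in I, α s * (∫⁻ y in B, g (s, y)) + β s * (∫⁻ y in B, g (s, y) ^ r) ^ (1 / r) := by
  set S : Set (ℝ × X) := I ×ˢ B with hS
  -- a measurable representative of `g` on `S`, and its slices
  set g' : ℝ × X → ℝ≥0∞ := hg.mk g with hg'
  have hg'm : Measurable g' := hg.measurable_mk
  have hgg' : g =ᵐ[volume.restrict S] g' := hg.ae_eq_mk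
  have hprod : (volume.restrict S : Measure (ℝ × X)) =
      (volume.restrict I).prod (volume.restrict B) := by
    rw [hS, Measure.volume_eq_prod, Measure.prod_restrict]
  have hslice : ∀ᵐ s ∂(volume.restrict I), ∀ᵐ y ∂(volume.restrict B), g (s, y) = g' (s, y) := by
    rw [hprod] at hgg'
    exact Measure.ae_ae_of_ae_prod hgg'
  have hmain := lintegral_enorm_mul_le_mixed_of_forall_test_of_measurable hI hB hBfin hE hα hβ
    hαI hβI hr h hg'm
  calc ∫⁻ z in S, ‖E z‖ₑ * g z = ∫⁻ z in S, ‖E z‖ₑ * g' z :=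
        lintegral_congr_ae (hgg'.mono fun z hz => by simp only [hz])
    _ ≤ ∫⁻ s in I, α s * (∫⁻ y in B, g' (s, y)) + β s * (∫⁻ y in B, g' (s, y) ^ r) ^ (1 / r) :=
        hmain
    _ = ∫⁻ s in I, α s * (∫⁻ y in B, g (s, y)) + β s * (∫⁻ y in B, g (s, y) ^ r) ^ (1 / r) := by
        refine lintegral_congr_ae (hslice.mono fun s hs => ?_)
        dsimp only
        rw [lintegral_congr_ae (hs.mono fun y hy => show g' (s, y) = g (s, y) by rw [hy]),
          lintegral_congr_ae (hs.mono fun y hy => show g' (s, y) ^ r = g (s, y) ^ r by rw [hy])]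

end Literature.Analysis.FunctionSpaces
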